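import Mathlib
import Literature.Barriers.ValiantsHypothesis.AlgebraicNaturalProofs
import Summits.ValiantsHypothesis.ValiantsHypothesis.Theorems.BarrierLeverPartitionMinorsSubsetSumWitness
import Summits.ValiantsHypothesis.ValiantsHypothesis.Theorems.BarrierLeverPartitionMinorsSubsetSumRecursiveSplits

/-!
# Route BarrierLever — item `PartitionMinorsHitByVP` (stmt-ValiantsHypothesis-19717):
# the SUBSET-SUM VANDERMONDE witness — size, degree, and the DOOR

Helper file (`--supports stmt-ValiantsHypothesis-19717`; cell valiant-natproofs, rung V4, 𝒟-side of
door (c); prover seat val-np-p3 gen 4). Definition-free, cone-free. Closes NO item. Part 3 of the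
subset-sum witness (memo `HOME/val-np-p3/g4/evidence-subsetsum-witness-valnp3-g4.md`).

The witness is the degree-`≤ 2h` truncation `f_Γ = Σ_{e ≤ 2h} F_Γ^{(e)}` of
`F_Γ = G_none · ∏_a (1 + x_a · G_{some a})`, `G_o = ∏_c (1 + Γ o c · y_c)` (all written out).

* `complexity_subsetSumF_le` — `L(F_Γ) ≤ 3h² + 6h + 1`; `subsetSumWitness_mem_smallCircuits` — by the
  Literature homogenisation bound (`complexity_sum_homogeneousComponent_le`, BCS Lemma 21.25)
  `L(f_Γ) ≤ (2h+2)²(3h²+6h+1) + 2h + 1 ≤ (h+h)^5` and `deg f_Γ ≤ 2h`, so `f_Γ ∈ SmallCircuits ℂ (h+h) 5`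
  for `h ≥ 4`.
* **`partitionMinor_hit_of_subsetSumVandermonde`** (THE DOOR, `b = 5`, `h ≥ 4`): a layout `(u, w)` of
  any size `r` is hit inside `SmallCircuits ℂ (h+h) 5` as soon as SOME table `Γ` makes the generalized
  Vandermonde `(∏_{c ∈ w_j} (Γ none c + Σ_{a ∈ u_i} Γ (some a) c))_{i,j}` nonsingular — i.e. as soon as
  the monomials `z^{w_j}` are unisolvent on some affine image of the `0/1` points `1_{u_i}`.
* **`partitionMinor_hit_of_unisolvent_cubeColumns`** — columns = ALL subsets of a block `T`, rows
  unisolvent on `T` for some `Γ` (in particular rows that split recursively into halves by level sets of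
  the coordinates, `…SubsetSumRecursiveSplits.unisolvent_split`) ⇒ hit.
* **`partitionMinor_hit_of_cubeEncoding`** — columns = all subsets of `T`, and some table `Γ` with
  `0/1` subset sums on `T` encodes the rows bijectively onto `𝒫(T)` ⇒ hit (the layout matrix is then
  the inclusion matrix of `𝒫(T)`).

SCOPE. `f_Γ` is read-once in `x` and dense in `y`; its transpose (`x ↔ y`) is the witness for
(cube rows) × (any columns). Which row families are unisolvent for generic `Γ` is the EVEN-SPLIT
question of the memo (every family of `2^j` distinct sets, conjecturally; proved for `2^j ≤ 8`;
verified numerically far beyond). Nothing here bears on crux 14610 or `VP ≠ VNP`.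
-/

set_option linter.dupNamespace false

open Finset MvPolynomial

namespace Summit.ValiantsHypothesis.ValiantsHypothesis.Theorems.BarrierLever.SubsetSum

open Literature.Barriers.ValiantsHypothesis Literature.Computability.AlgebraicComplexity

noncomputable section

variable {h : ℕ}

/-! ## 1. Size and degree -/

/-- `L(G_o) ≤ 3h` for `G_o = ∏_c (1 + Γ o c · y_c)`. -/
theorem complexity_G_le (γ : Fin h → ℂ) :
    complexity (∏ c : Fin h, (1 + C (γ c) * X (Fin.natAdd h c)) : MvPolynomial (Fin (h + h)) ℂ) ≤
      3 * h := by
  have hfac : ∀ c : Fin h, complexity ((1 + C (γ c) * X (Fin.natAdd h c)) :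
      MvPolynomial (Fin (h + h)) ℂ) ≤ 2 := by
    intro c
    calc complexity ((1 + C (γ c) * X (Fin.natAdd h c)) : MvPolynomial (Fin (h + h)) ℂ)
        ≤ complexity (1 : MvPolynomial (Fin (h + h)) ℂ) +
            complexity (C (γ c) * X (Fin.natAdd h c) : MvPolynomial (Fin (h + h)) ℂ) + 1 :=
          complexity_add_le_holds _ _
      _ ≤ complexity (1 : MvPolynomial (Fin (h + h)) ℂ) +
            (complexity (C (γ c) : MvPolynomial (Fin (h + h)) ℂ) +
              complexity (X (Fin.natAdd h c) : MvPolynomial (Fin (h + h)) ℂ) + 1) + 1 := by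
          gcongr; exact complexity_mul_le_holds _ _
      _ = 2 := by rw [← C_1, complexity_C_holds, complexity_C_holds, complexity_X_holds]
  calc complexity (∏ c : Fin h, (1 + C (γ c) * X (Fin.natAdd h c)) : MvPolynomial (Fin (h + h)) ℂ)
      ≤ ∑ c : Fin h, complexity ((1 + C (γ c) * X (Fin.natAdd h c)) : MvPolynomial (Fin (h + h)) ℂ) +
          (Finset.univ : Finset (Fin h)).card := complexity_finset_prod_le _ _
    _ ≤ ∑ _c : Fin h, 2 + (Finset.univ : Finset (Fin h)).card := by gcongr with c _; exact hfac c
    _ = 3 * h := by simp; ring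

/-- `L(F_Γ) ≤ 3h² + 6h + 1`. -/
theorem complexity_subsetSumF_le (Γ : Option (Fin h) → Fin h → ℂ) :
    complexity ((∏ c : Fin h, (1 + C (Γ none c) * X (Fin.natAdd h c))) *
        ∏ a : Fin h, (1 + X (Fin.castAdd h a) *
          ∏ c : Fin h, (1 + C (Γ (some a) c) * X (Fin.natAdd h c))) : MvPolynomial (Fin (h + h)) ℂ) ≤
      3 * h ^ 2 + 6 * h + 1 := by
  have hfac : ∀ a : Fin h, complexity ((1 + X (Fin.castAdd h a) *
      ∏ c : Fin h, (1 + C (Γ (some a) c) * X (Fin.natAdd h c))) : MvPolynomial (Fin (h + h)) ℂ) ≤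
      3 * h + 2 := by
    intro a
    calc complexity ((1 + X (Fin.castAdd h a) *
          ∏ c : Fin h, (1 + C (Γ (some a) c) * X (Fin.natAdd h c))) : MvPolynomial (Fin (h + h)) ℂ)
        ≤ complexity (1 : MvPolynomial (Fin (h + h)) ℂ) + complexity (X (Fin.castAdd h a) *
            ∏ c : Fin h, (1 + C (Γ (some a) c) * X (Fin.natAdd h c)) : MvPolynomial (Fin (h + h)) ℂ) +
            1 := complexity_add_le_holds _ _
      _ ≤ complexity (1 : MvPolynomial (Fin (h + h)) ℂ) +
            (complexity (X (Fin.castAdd h a) : MvPolynomial (Fin (h + h)) ℂ) +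
              complexity (∏ c : Fin h, (1 + C (Γ (some a) c) * X (Fin.natAdd h c)) :
                MvPolynomial (Fin (h + h)) ℂ) + 1) + 1 := by
          gcongr; exact complexity_mul_le_holds _ _
      _ ≤ 0 + (0 + 3 * h + 1) + 1 := by
          rw [← C_1, complexity_C_holds, complexity_X_holds]
          gcongr; exact complexity_G_le _
      _ = 3 * h + 2 := by ring
  calc complexity ((∏ c : Fin h, (1 + C (Γ none c) * X (Fin.natAdd h c))) *
        ∏ a : Fin h, (1 + X (Fin.castAdd h a) *
          ∏ c : Fin h, (1 + C (Γ (some a) c) * X (Fin.natAdd h c))) : MvPolynomial (Fin (h + h)) ℂ)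
      ≤ complexity (∏ c : Fin h, (1 + C (Γ none c) * X (Fin.natAdd h c)) : MvPolynomial (Fin (h + h)) ℂ) +
          complexity (∏ a : Fin h, (1 + X (Fin.castAdd h a) *
            ∏ c : Fin h, (1 + C (Γ (some a) c) * X (Fin.natAdd h c))) : MvPolynomial (Fin (h + h)) ℂ) +
          1 := complexity_mul_le_holds _ _
    _ ≤ 3 * h + (∑ a : Fin h, complexity ((1 + X (Fin.castAdd h a) *
            ∏ c : Fin h, (1 + C (Γ (some a) c) * X (Fin.natAdd h c))) : MvPolynomial (Fin (h + h)) ℂ) +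
          (Finset.univ : Finset (Fin h)).card) + 1 := by
        gcongr
        · exact complexity_G_le _
        · exact complexity_finset_prod_le _ _
    _ ≤ 3 * h + (∑ _a : Fin h, (3 * h + 2) + (Finset.univ : Finset (Fin h)).card) + 1 := by
        gcongr with a _; exact hfac a
    _ = 3 * h ^ 2 + 6 * h + 1 := by simp; ring

/-- **Membership.** For `h ≥ 4` the truncated witness `f_Γ = Σ_{e ≤ 2h} F_Γ^{(e)}` lies in
`SmallCircuits ℂ (h+h) 5`: degree `≤ 2h`, size `≤ (2h+2)²(3h²+6h+1) + 2h + 1 ≤ (2h)^5`. -/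
theorem subsetSumWitness_mem_smallCircuits (hh : 4 ≤ h) (Γ : Option (Fin h) → Fin h → ℂ) :
    (∑ e ∈ Finset.range (h + h + 1), homogeneousComponent e
        ((∏ c : Fin h, (1 + C (Γ none c) * X (Fin.natAdd h c))) *
          ∏ a : Fin h, (1 + X (Fin.castAdd h a) *
            ∏ c : Fin h, (1 + C (Γ (some a) c) * X (Fin.natAdd h c))) : MvPolynomial (Fin (h + h)) ℂ)) ∈
      SmallCircuits ℂ (h + h) 5 := by
  refine ⟨SahaThankey2021.Trunc.totalDegree_trunc_le _ _,
    (complexity_sum_homogeneousComponent_le _ _).trans ?_⟩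
  have hL := complexity_subsetSumF_le Γ
  calc (h + h + 2) ^ 2 * complexity ((∏ c : Fin h, (1 + C (Γ none c) * X (Fin.natAdd h c))) *
          ∏ a : Fin h, (1 + X (Fin.castAdd h a) *
            ∏ c : Fin h, (1 + C (Γ (some a) c) * X (Fin.natAdd h c))) : MvPolynomial (Fin (h + h)) ℂ) +
          (h + h + 1)
      ≤ (h + h + 2) ^ 2 * (3 * h ^ 2 + 6 * h + 1) + (h + h + 1) := by gcongr
    _ ≤ (3 * h) ^ 2 * (5 * h ^ 2) + h ^ 2 := by
        gcongr ?_ ^ 2 * ?_ + ?_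
        · omega
        · nlinarith
        · nlinarith
    _ ≤ (h + h) ^ 5 := by
        have e : (h + h) ^ 5 = 32 * h * h ^ 4 := by ring
        have e' : (3 * h) ^ 2 * (5 * h ^ 2) + h ^ 2 = 45 * h ^ 4 + h ^ 2 := by ring
        have h2' : h ^ 2 ≤ h ^ 4 := Nat.pow_le_pow_right (by omega) (by norm_num)
        rw [e, e']
        nlinarith [h2', Nat.zero_le (h ^ 4), hh]

/-! ## 2. The door -/

/-- **The subset-sum door.** Let `h ≥ 4` and let `(u, w)` be any layout (`r` rows and columns). If for
some table `Γ : Option (Fin h) → Fin h → ℂ` the generalized Vandermonde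
`(∏_{c ∈ w j} (Γ none c + Σ_{a ∈ u i} Γ (some a) c))_{i,j}` — the monomials `z^{w_j}` at the subset
sums `Q_{u_i} = Γ₀ + Σ_{a∈u_i} Γ_a` — is nonsingular, then the layout is hit inside
`SmallCircuits ℂ (h+h) 5` (item 19717's conclusion for this layout), by the truncated witness `f_Γ`. -/
theorem partitionMinor_hit_of_subsetSumVandermonde (hh : 4 ≤ h) {r : ℕ}
    (u w : Fin r → Finset (Fin h)) (Γ : Option (Fin h) → Fin h → ℂ)
    (hdet : (Matrix.of fun i j : Fin r =>
      ∏ c ∈ w j, (Γ none c + ∑ a ∈ u i, Γ (some a) c)).det ≠ 0) :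
    ∃ f ∈ SmallCircuits ℂ (h + h) 5,
      (Matrix.of fun i j : Fin r => MvPolynomial.coeff
        (∑ a ∈ u i, Finsupp.single (Fin.castAdd h a) 1 +
          ∑ c ∈ w j, Finsupp.single (Fin.natAdd h c) 1) f).det ≠ 0 := by
  refine ⟨_, subsetSumWitness_mem_smallCircuits hh Γ, ?_⟩
  have hM : (Matrix.of fun i j : Fin r => MvPolynomial.coeff
        (∑ a ∈ u i, Finsupp.single (Fin.castAdd h a) 1 +
          ∑ c ∈ w j, Finsupp.single (Fin.natAdd h c) 1)
        (∑ e ∈ Finset.range (h + h + 1), homogeneousComponent e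
          ((∏ c : Fin h, (1 + C (Γ none c) * X (Fin.natAdd h c))) *
            ∏ a : Fin h, (1 + X (Fin.castAdd h a) *
              ∏ c : Fin h, (1 + C (Γ (some a) c) * X (Fin.natAdd h c))) :
                MvPolynomial (Fin (h + h)) ℂ))) =
      Matrix.of fun i j : Fin r => ∏ c ∈ w j, (Γ none c + ∑ a ∈ u i, Γ (some a) c) := by
    ext i j
    simp only [Matrix.of_apply]
    exact coeff_partition_trunc_subsetSumF Γ (u i) (w j)
  rw [hM]
  exact hdet

/-- **Cube columns, unisolvent rows.** Let `h ≥ 4`, let the columns `w j` enumerate ALL subsets of a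
block `T ⊆ Fin h` bijectively, and suppose that for some table `Γ` the subset-sum points
`P_i(c) = Γ none c + Σ_{a ∈ u i} Γ (some a) c` are UNISOLVENT on `T` (every multiaffine polynomial
in the `T`-coordinates vanishing at all `P_i` is zero — e.g. because the rows split recursively into
halves by level sets of the coordinates, `unisolvent_split`). Then the layout is hit inside
`SmallCircuits ℂ (h+h) 5`. -/
theorem partitionMinor_hit_of_unisolvent_cubeColumns (hh : 4 ≤ h) {r : ℕ}
    (u w : Fin r → Finset (Fin h)) (T : Finset (Fin h)) (hwT : ∀ j, w j ⊆ T)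
    (hwinj : Function.Injective w) (hwsurj : ∀ W, W ⊆ T → ∃ j, w j = W)
    (Γ : Option (Fin h) → Fin h → ℂ)
    (huni : ∀ c : Finset (Fin h) → ℂ,
      (∀ i ∈ (Finset.univ : Finset (Fin r)), (∑ W ∈ T.powerset, c W *
        ∏ x ∈ W, (Γ none x + ∑ a ∈ u i, Γ (some a) x)) = 0) →
      ∀ W ∈ T.powerset, c W = 0) :
    ∃ f ∈ SmallCircuits ℂ (h + h) 5,
      (Matrix.of fun i j : Fin r => MvPolynomial.coeff
        (∑ a ∈ u i, Finsupp.single (Fin.castAdd h a) 1 +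
          ∑ c ∈ w j, Finsupp.single (Fin.natAdd h c) 1) f).det ≠ 0 :=
  partitionMinor_hit_of_subsetSumVandermonde hh u w Γ
    (det_ne_zero_of_unisolvent (fun i x => Γ none x + ∑ a ∈ u i, Γ (some a) x) T w hwT hwinj
      hwsurj huni)

/-- **Cube columns, cube-encoded rows.** Let `h ≥ 4`, let the columns enumerate all subsets of `T`,
and suppose some table `Γ` has `0/1` subset sums on `T` which ENCODE the rows onto `𝒫(T)`: every
`W ⊆ T` is the `T`-support `{c ∈ T : P_i(c) = 1}` of some row. Then the layout is hit inside
`SmallCircuits ℂ (h+h) 5` (its matrix at `f_Γ` is the inclusion matrix of `𝒫(T)`). Examples: rows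
`∅` and singletons (binary codes of the elements), one-element-per-block rows (concatenated codes),
the cube `𝒫(T)` itself. -/
theorem partitionMinor_hit_of_cubeEncoding (hh : 4 ≤ h) {r : ℕ}
    (u w : Fin r → Finset (Fin h)) (T : Finset (Fin h)) (hwT : ∀ j, w j ⊆ T)
    (hwinj : Function.Injective w) (hwsurj : ∀ W, W ⊆ T → ∃ j, w j = W)
    (Γ : Option (Fin h) → Fin h → ℂ)
    (h01 : ∀ i, ∀ x ∈ T, (Γ none x + ∑ a ∈ u i, Γ (some a) x) = 0 ∨
      (Γ none x + ∑ a ∈ u i, Γ (some a) x) = 1)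
    (henc : ∀ W, W ⊆ T → ∃ i, ∀ x ∈ T, (Γ none x + ∑ a ∈ u i, Γ (some a) x) = 1 ↔ x ∈ W) :
    ∃ f ∈ SmallCircuits ℂ (h + h) 5,
      (Matrix.of fun i j : Fin r => MvPolynomial.coeff
        (∑ a ∈ u i, Finsupp.single (Fin.castAdd h a) 1 +
          ∑ c ∈ w j, Finsupp.single (Fin.natAdd h c) 1) f).det ≠ 0 :=
  partitionMinor_hit_of_unisolvent_cubeColumns hh u w T hwT hwinj hwsurj Γ
    (unisolvent_cube (fun i x => Γ none x + ∑ a ∈ u i, Γ (some a) x) T Finset.univ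
      (fun i _ x hx => h01 i x hx) (fun W hW => by
        obtain ⟨i, hi⟩ := henc W hW
        exact ⟨i, Finset.mem_univ _, hi⟩))

end

end Summit.ValiantsHypothesis.ValiantsHypothesis.Theorems.BarrierLever.SubsetSum
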